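/-
Copyright: the b2b-balaban T⁴-continuum CRUX team, row NE7b OWNER lineage `t4-ne7b-p1` (gen 109). Project licence.
-/
import Literature.Analysis.Convexity.PrekopaLeindler
import Mathlib.Analysis.Convex.Strong
import Mathlib.Analysis.InnerProductSpace.Basic
import Mathlib.Analysis.SpecialFunctions.Pow.Real
import Mathlib.Analysis.Calculus.Gradient.Basic
import Mathlib.Analysis.Calculus.Deriv.Slope
import Mathlib.Analysis.Calculus.Deriv.Mul
import Mathlib.Analysis.Calculus.Deriv.Add
import Mathlib.Analysis.Calculus.Deriv.Comp

/-!
# THE CONVEXITY MODULUS SURVIVES A FLUCTUATION INTEGRAL: Prékopa's theorem and the Brascamp–Lieb marginal inequality ON A CONVEX WINDOW —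
# `x ↦ −log ∫_{K_x} e^{−V(x,y)} dy` inherits the base-direction modulus of `V` (row NE7b, node U5c; residual (R2′) family (2), letter (ℓ1) «λ ON K»)

Cell `pub-balaban`, sub-cell `t4`, spine estimate NE7b (`T4WeightBudget.RelWeightBound`; the cell's OWN estimate — NOT PRINTED in [Bałaban 1983–89], NOT
PROVED).  Crux-route work under `Spine/NE7b/` by the row's OWNER; NOTHING of Bałaban's is named or asserted; no `T4Continuum/Support` leaf typed; no `def`;
zero `sorry`.  Imports: the tree's PROVED `Literature.Analysis.Convexity.prekopaLeindler` and Mathlib only.  WHY: every socket of the windowed convexity road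
consumes the letter «`V` is `λ`-uniformly convex ON the convex window `K`»; the suppliers in the tree read it from the action AT THE CURRENT SCALE, while a
renormalisation step PRODUCES the next exponent as `V⁺(x) = −log ∫_{K_x} e^{−V(x,y)} dy`; Prékopa (1973) and Brascamp–Lieb (1976, Thm 4.3) say the modulus in
the kept variables survives — this file is those theorems on a convex window, in the secant currency, so the letter can be INHERITED across a step.
WHAT IS PROVED ([folklore]): §1 `lintegral_fibre_rpow_mul_rpow_le` — two-point inequality for the fibre integrals of `1_K e^{−V}` (`ℝ≥0∞`, any constant `c`:
`(∫_{K_{x₀}} e^{−V(x₀,·)})^{1−s}(∫_{K_{x₁}} e^{−V(x₁,·)})^{s} ≤ e^{−c}∫_{K_{x_s}} e^{−V(x_s,·)}` when `V(x_s,y_s) + c ≤ (1−s)V(x₀,y₀) + sV(x₁,y₁)` along `K`);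
§2 Bochner and `−log` forms; §3 `strongConvexOn_neg_log_fibreIntegral` (`StrongConvexOn B λ` of the windowed marginal), `convexOn_neg_log_fibreIntegral`
(Prékopa), `…_neg_log_integral` (no window); §4 first-order ⟹ secant; §5 round trip first-order ⟺ `StrongConvexOn`; §6 an ARBITRARY base functional `Q`.
NOT HERE (honest): which of print's steps have this form with a convex joint window, the rescaling between scales, the background dependence ((A3)∕(A1c),
programme-sized, NC-NE7b-α UNRULED); the base∕fibre splitting of a socket's single Euclidean carrier (a transport as in `…ConvexTiltMomentPi`); anything of
Bałaban's.  NE7b NOT PRINTED ∕ NOT PROVED; spine PROVED 0∕9; rung (B)+1 on a FINITE torus — NOT infinite volume, NOT the mass gap, NOT Clay.  HONEST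
DEPENDENCY: continuum YM on T⁴ ⇐ BetaPertH ∧ nine spine estimates (0/9 proved); BetaPertH ⇐ (D1) ∧ (D4) ∧ CAP+tail. -/

set_option autoImplicit false

noncomputable section

open MeasureTheory Real Set
open scoped ENNReal RealInnerProductSpace

namespace Summit.QuantumFields.BalabanUV.T4Continuum.NE7b.LogConcaveMarginal

/-! ## §1 The two-point inequality in `ℝ≥0∞` form (Prékopa–Leindler applied fibrewise) -/

section TwoPoint

variable {m n : ℕ}

/-- Fibres of a measurable set in the product are measurable. [folklore] -/
theorem measurableSet_fibre {K : Set (EuclideanSpace ℝ (Fin m) × EuclideanSpace ℝ (Fin n))} (hK : MeasurableSet K)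
    (x : EuclideanSpace ℝ (Fin m)) : MeasurableSet (Prod.mk x ⁻¹' K) :=
  measurable_prodMk_left hK

/-- The fibre density `y ↦ e^{−V(x,y)}` of a measurable exponent is measurable (as an `ℝ≥0∞`-valued function). [folklore] -/
theorem measurable_fibreDensity {V : EuclideanSpace ℝ (Fin m) × EuclideanSpace ℝ (Fin n) → ℝ} (hV : Measurable V)
    (x : EuclideanSpace ℝ (Fin m)) : Measurable fun y : EuclideanSpace ℝ (Fin n) => ENNReal.ofReal (exp (-V (x, y))) :=
  (hV.comp measurable_prodMk_left).neg.exp.ennreal_ofReal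

/-- **THE TWO-POINT MARGINAL INEQUALITY** (Prékopa 1973 for `c = 0`; Brascamp–Lieb 1976 Thm 4.3 for `c = (λ∕2)s(1−s)‖x₁−x₀‖²`),
`ℝ≥0∞` form.  Let `K ⊆ ℝᵐ × ℝⁿ` be measurable, `V` measurable, `0 < s < 1`, `x₀, x₁` base points, `x_s = (1−s)x₀ + s x₁`, and suppose that
for all `y₀ ∈ K_{x₀}`, `y₁ ∈ K_{x₁}` the interpolant `(x_s, (1−s)y₀ + s y₁)` lies in `K` and
`V(x_s, (1−s)y₀ + s y₁) + c ≤ (1−s)V(x₀,y₀) + sV(x₁,y₁)`.  Then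
`(∫_{K_{x₀}} e^{−V(x₀,·)})^{1−s}(∫_{K_{x₁}} e^{−V(x₁,·)})^{s} ≤ e^{−c}∫_{K_{x_s}} e^{−V(x_s,·)}` — Prékopa–Leindler for the indicator-weighted
fibre densities. [cite: BrascampLieb1976, Thm 4.3] -/
theorem lintegral_fibre_rpow_mul_rpow_le {s c : ℝ} (hs0 : 0 < s) (hs1 : s < 1)
    {K : Set (EuclideanSpace ℝ (Fin m) × EuclideanSpace ℝ (Fin n))} (hK : MeasurableSet K)
    {V : EuclideanSpace ℝ (Fin m) × EuclideanSpace ℝ (Fin n) → ℝ} (hV : Measurable V)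
    {x₀ x₁ : EuclideanSpace ℝ (Fin m)}
    (hVc : ∀ y₀ y₁ : EuclideanSpace ℝ (Fin n), (x₀, y₀) ∈ K → (x₁, y₁) ∈ K →
      ((1 - s) • x₀ + s • x₁, (1 - s) • y₀ + s • y₁) ∈ K ∧
        V ((1 - s) • x₀ + s • x₁, (1 - s) • y₀ + s • y₁) + c ≤ (1 - s) * V (x₀, y₀) + s * V (x₁, y₁)) :
    (∫⁻ y in Prod.mk x₀ ⁻¹' K, ENNReal.ofReal (exp (-V (x₀, y)))) ^ (1 - s) *
        (∫⁻ y in Prod.mk x₁ ⁻¹' K, ENNReal.ofReal (exp (-V (x₁, y)))) ^ s ≤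
      ENNReal.ofReal (exp (-c)) *
        ∫⁻ y in Prod.mk ((1 - s) • x₀ + s • x₁) ⁻¹' K, ENNReal.ofReal (exp (-V ((1 - s) • x₀ + s • x₁, y))) := by
  have h1s : 0 < 1 - s := by linarith
  have hfm : Measurable ((Prod.mk x₀ ⁻¹' K).indicator fun y => ENNReal.ofReal (exp (-V (x₀, y)))) :=
    (measurable_fibreDensity hV x₀).indicator (measurableSet_fibre hK x₀)
  have hgm : Measurable ((Prod.mk x₁ ⁻¹' K).indicator fun y => ENNReal.ofReal (exp (-V (x₁, y)))) :=
    (measurable_fibreDensity hV x₁).indicator (measurableSet_fibre hK x₁)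
  have him : Measurable ((Prod.mk ((1 - s) • x₀ + s • x₁) ⁻¹' K).indicator
      fun y => ENNReal.ofReal (exp (-V ((1 - s) • x₀ + s • x₁, y)))) :=
    (measurable_fibreDensity hV _).indicator (measurableSet_fibre hK _)
  have hhm : Measurable fun y => ENNReal.ofReal (exp (-c)) *
      (Prod.mk ((1 - s) • x₀ + s • x₁) ⁻¹' K).indicator
        (fun y => ENNReal.ofReal (exp (-V ((1 - s) • x₀ + s • x₁, y)))) y :=
    him.const_mul _
  have key := Literature.Analysis.Convexity.prekopaLeindler hs0 hs1 hfm hgm hhm (fun y₀ y₁ => by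
    beta_reduce
    by_cases h0 : y₀ ∈ Prod.mk x₀ ⁻¹' K
    · by_cases h1 : y₁ ∈ Prod.mk x₁ ⁻¹' K
      · obtain ⟨hmem, hle⟩ := hVc y₀ y₁ h0 h1
        have hmem' : (1 - s) • y₀ + s • y₁ ∈ Prod.mk ((1 - s) • x₀ + s • x₁) ⁻¹' K := hmem
        rw [indicator_of_mem h0, indicator_of_mem h1, indicator_of_mem hmem']
        beta_reduce
        rw [ENNReal.ofReal_rpow_of_nonneg (exp_pos _).le h1s.le, ENNReal.ofReal_rpow_of_nonneg (exp_pos _).le hs0.le,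
          ← ENNReal.ofReal_mul (rpow_nonneg (exp_pos _).le _), ← ENNReal.ofReal_mul (exp_pos _).le]
        refine ENNReal.ofReal_le_ofReal ?_
        rw [← exp_mul, ← exp_mul, ← exp_add, ← exp_add, exp_le_exp]
        nlinarith [hle]
      · simp [indicator_of_notMem h1, ENNReal.zero_rpow_of_pos hs0]
    · simp [indicator_of_notMem h0, ENNReal.zero_rpow_of_pos h1s])
  rwa [lintegral_indicator (measurableSet_fibre hK x₀), lintegral_indicator (measurableSet_fibre hK x₁),
    lintegral_const_mul _ him, lintegral_indicator (measurableSet_fibre hK _)] at key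

end TwoPoint

/-! ## §2 Bochner form and the `−log` (secant) form -/

section Bochner

variable {m n : ℕ}

/-- **THE TWO-POINT MARGINAL INEQUALITY, Bochner form**: under the hypotheses of `lintegral_fibre_rpow_mul_rpow_le` and integrability of
the three fibre densities, `(∫_{K_{x₀}} e^{−V(x₀,·)})^{1−s}(∫_{K_{x₁}} e^{−V(x₁,·)})^{s} ≤ e^{−c}∫_{K_{x_s}} e^{−V(x_s,·)}`.
[cite: BrascampLieb1976, Thm 4.3] -/
theorem fibreIntegral_rpow_mul_rpow_le {s c : ℝ} (hs0 : 0 < s) (hs1 : s < 1)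
    {K : Set (EuclideanSpace ℝ (Fin m) × EuclideanSpace ℝ (Fin n))} (hK : MeasurableSet K)
    {V : EuclideanSpace ℝ (Fin m) × EuclideanSpace ℝ (Fin n) → ℝ} (hV : Measurable V)
    {x₀ x₁ : EuclideanSpace ℝ (Fin m)}
    (hVc : ∀ y₀ y₁ : EuclideanSpace ℝ (Fin n), (x₀, y₀) ∈ K → (x₁, y₁) ∈ K →
      ((1 - s) • x₀ + s • x₁, (1 - s) • y₀ + s • y₁) ∈ K ∧
        V ((1 - s) • x₀ + s • x₁, (1 - s) • y₀ + s • y₁) + c ≤ (1 - s) * V (x₀, y₀) + s * V (x₁, y₁))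
    (hI₀ : IntegrableOn (fun y => exp (-V (x₀, y))) (Prod.mk x₀ ⁻¹' K))
    (hI₁ : IntegrableOn (fun y => exp (-V (x₁, y))) (Prod.mk x₁ ⁻¹' K))
    (hIs : IntegrableOn (fun y => exp (-V ((1 - s) • x₀ + s • x₁, y))) (Prod.mk ((1 - s) • x₀ + s • x₁) ⁻¹' K)) :
    (∫ y in Prod.mk x₀ ⁻¹' K, exp (-V (x₀, y))) ^ (1 - s) * (∫ y in Prod.mk x₁ ⁻¹' K, exp (-V (x₁, y))) ^ s ≤
      exp (-c) * ∫ y in Prod.mk ((1 - s) • x₀ + s • x₁) ⁻¹' K, exp (-V ((1 - s) • x₀ + s • x₁, y)) := by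
  have h1s : 0 ≤ 1 - s := by linarith
  have key := lintegral_fibre_rpow_mul_rpow_le hs0 hs1 hK hV hVc
  have nn : ∀ (x : EuclideanSpace ℝ (Fin m)),
      0 ≤ ∫ y in Prod.mk x ⁻¹' K, exp (-V (x, y)) := fun x => integral_nonneg fun _ => (exp_pos _).le
  have conv : ∀ (x : EuclideanSpace ℝ (Fin m)), IntegrableOn (fun y => exp (-V (x, y))) (Prod.mk x ⁻¹' K) →
      ENNReal.ofReal (∫ y in Prod.mk x ⁻¹' K, exp (-V (x, y))) =
        ∫⁻ y in Prod.mk x ⁻¹' K, ENNReal.ofReal (exp (-V (x, y))) := fun x hx =>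
    ofReal_integral_eq_lintegral_ofReal hx (Filter.Eventually.of_forall fun _ => (exp_pos _).le)
  rw [← conv x₀ hI₀, ← conv x₁ hI₁, ← conv _ hIs,
    ENNReal.ofReal_rpow_of_nonneg (nn x₀) h1s, ENNReal.ofReal_rpow_of_nonneg (nn x₁) hs0.le,
    ← ENNReal.ofReal_mul (rpow_nonneg (nn x₀) _), ← ENNReal.ofReal_mul (exp_pos _).le] at key
  exact (ENNReal.ofReal_le_ofReal_iff (mul_nonneg (exp_pos _).le (nn _))).1 key

/-- **THE `−log` FORM**: with `F(x) = −log ∫_{K_x} e^{−V(x,·)}` and the three fibre integrals positive (and the densities integrable),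
`F(x_s) + c ≤ (1−s)F(x₀) + sF(x₁)`. [cite: BrascampLieb1976, Thm 4.3] -/
theorem neg_log_fibreIntegral_secant {s c : ℝ} (hs0 : 0 < s) (hs1 : s < 1)
    {K : Set (EuclideanSpace ℝ (Fin m) × EuclideanSpace ℝ (Fin n))} (hK : MeasurableSet K)
    {V : EuclideanSpace ℝ (Fin m) × EuclideanSpace ℝ (Fin n) → ℝ} (hV : Measurable V)
    {x₀ x₁ : EuclideanSpace ℝ (Fin m)}
    (hVc : ∀ y₀ y₁ : EuclideanSpace ℝ (Fin n), (x₀, y₀) ∈ K → (x₁, y₁) ∈ K →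
      ((1 - s) • x₀ + s • x₁, (1 - s) • y₀ + s • y₁) ∈ K ∧
        V ((1 - s) • x₀ + s • x₁, (1 - s) • y₀ + s • y₁) + c ≤ (1 - s) * V (x₀, y₀) + s * V (x₁, y₁))
    (hI₀ : IntegrableOn (fun y => exp (-V (x₀, y))) (Prod.mk x₀ ⁻¹' K))
    (hI₁ : IntegrableOn (fun y => exp (-V (x₁, y))) (Prod.mk x₁ ⁻¹' K))
    (hIs : IntegrableOn (fun y => exp (-V ((1 - s) • x₀ + s • x₁, y))) (Prod.mk ((1 - s) • x₀ + s • x₁) ⁻¹' K))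
    (hP₀ : 0 < ∫ y in Prod.mk x₀ ⁻¹' K, exp (-V (x₀, y)))
    (hP₁ : 0 < ∫ y in Prod.mk x₁ ⁻¹' K, exp (-V (x₁, y)))
    (hPs : 0 < ∫ y in Prod.mk ((1 - s) • x₀ + s • x₁) ⁻¹' K, exp (-V ((1 - s) • x₀ + s • x₁, y))) :
    -log (∫ y in Prod.mk ((1 - s) • x₀ + s • x₁) ⁻¹' K, exp (-V ((1 - s) • x₀ + s • x₁, y))) + c ≤
      (1 - s) * -log (∫ y in Prod.mk x₀ ⁻¹' K, exp (-V (x₀, y))) +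
        s * -log (∫ y in Prod.mk x₁ ⁻¹' K, exp (-V (x₁, y))) := by
  have key := fibreIntegral_rpow_mul_rpow_le hs0 hs1 hK hV hVc hI₀ hI₁ hIs
  have hlog := log_le_log (mul_pos (rpow_pos_of_pos hP₀ _) (rpow_pos_of_pos hP₁ _)) key
  rw [log_mul (rpow_pos_of_pos hP₀ _).ne' (rpow_pos_of_pos hP₁ _).ne', log_rpow hP₀, log_rpow hP₁,
    log_mul (exp_pos _).ne' hPs.ne', log_exp] at hlog
  linarith

end Bochner

/-! ## §3 The marginal letter: `StrongConvexOn` of `x ↦ −log ∫_{K_x} e^{−V(x,·)}` -/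

section Marginal

variable {m n : ℕ}

/-- **BRASCAMP–LIEB's MARGINAL INEQUALITY ON A CONVEX WINDOW** (Thm 4.3; Prékopa's theorem when `λ = 0`).  Let `K ⊆ ℝᵐ × ℝⁿ` be convex
and measurable, `V` measurable and convex on `K`, `λ`-uniformly in the BASE direction:
`V(a p + b q) + (λ∕2)·a·b·‖q₁ − p₁‖² ≤ a V(p) + b V(q)` for `p, q ∈ K`, `a, b ≥ 0`, `a + b = 1`.  Let `B` be a convex set of base points
over which the fibre densities `e^{−V(x,·)}` are integrable on `K_x` with positive integral.  Then the windowed marginal exponent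
`x ↦ −log ∫_{K_x} e^{−V(x,·)}` is `λ`-strongly convex on `B` (`StrongConvexOn B λ`): THE MODULUS IN THE KEPT VARIABLES SURVIVES THE
INTEGRATION OF THE OTHERS. [cite: BrascampLieb1976, Thm 4.3] -/
theorem strongConvexOn_neg_log_fibreIntegral {lam : ℝ}
    {K : Set (EuclideanSpace ℝ (Fin m) × EuclideanSpace ℝ (Fin n))} (hK : MeasurableSet K) (hKc : Convex ℝ K)
    {V : EuclideanSpace ℝ (Fin m) × EuclideanSpace ℝ (Fin n) → ℝ} (hV : Measurable V)
    (hVc : ∀ p ∈ K, ∀ q ∈ K, ∀ a b : ℝ, 0 ≤ a → 0 ≤ b → a + b = 1 →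
      V (a • p + b • q) + lam / 2 * a * b * ‖q.1 - p.1‖ ^ 2 ≤ a * V p + b * V q)
    {B : Set (EuclideanSpace ℝ (Fin m))} (hB : Convex ℝ B)
    (hint : ∀ x ∈ B, IntegrableOn (fun y => exp (-V (x, y))) (Prod.mk x ⁻¹' K))
    (hpos : ∀ x ∈ B, 0 < ∫ y in Prod.mk x ⁻¹' K, exp (-V (x, y))) :
    StrongConvexOn B lam fun x => -log (∫ y in Prod.mk x ⁻¹' K, exp (-V (x, y))) := by
  refine ⟨hB, fun x₀ hx₀ x₁ hx₁ a b ha hb hab => ?_⟩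
  rcases hb.eq_or_lt with rfl | hb0
  · have ha1 : a = 1 := by linarith
    subst ha1
    simp
  rcases eq_or_lt_of_le (show b ≤ 1 by linarith) with rfl | hb1
  · have ha0 : a = 0 := by linarith
    subst ha0
    simp
  have ha' : a = 1 - b := by linarith
  subst ha'
  have hxs : (1 - b) • x₀ + b • x₁ ∈ B := hB hx₀ hx₁ ha hb hab
  have hVc' : ∀ y₀ y₁ : EuclideanSpace ℝ (Fin n), (x₀, y₀) ∈ K → (x₁, y₁) ∈ K →
      ((1 - b) • x₀ + b • x₁, (1 - b) • y₀ + b • y₁) ∈ K ∧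
        V ((1 - b) • x₀ + b • x₁, (1 - b) • y₀ + b • y₁) + lam / 2 * (1 - b) * b * ‖x₁ - x₀‖ ^ 2 ≤
          (1 - b) * V (x₀, y₀) + b * V (x₁, y₁) := by
    intro y₀ y₁ h0 h1
    have e : (1 - b) • (x₀, y₀) + b • (x₁, y₁) = ((1 - b) • x₀ + b • x₁, (1 - b) • y₀ + b • y₁) := by
      simp only [Prod.smul_mk, Prod.mk_add_mk]
    refine ⟨e ▸ hKc h0 h1 ha hb hab, ?_⟩
    have h := hVc _ h0 _ h1 (1 - b) b ha hb hab
    rwa [e] at h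
  have key := neg_log_fibreIntegral_secant hb0 hb1 hK hV hVc' (hint x₀ hx₀) (hint x₁ hx₁) (hint _ hxs)
    (hpos x₀ hx₀) (hpos x₁ hx₁) (hpos _ hxs)
  rw [norm_sub_rev x₀ x₁]
  simp only [smul_eq_mul]
  linarith

/-- **PRÉKOPA's THEOREM ON A CONVEX WINDOW** (`λ = 0`): `K` convex measurable, `V` measurable and convex on `K`, fibre densities integrable
with positive integral over the convex base set `B` ⟹ the windowed marginal of the log-concave density `1_K e^{−V}` is log-concave on `B`:
`ConvexOn ℝ B (x ↦ −log ∫_{K_x} e^{−V(x,·)})`. [cite: BrascampLieb1976, Thm 4.3] -/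
theorem convexOn_neg_log_fibreIntegral
    {K : Set (EuclideanSpace ℝ (Fin m) × EuclideanSpace ℝ (Fin n))} (hK : MeasurableSet K) (hKc : Convex ℝ K)
    {V : EuclideanSpace ℝ (Fin m) × EuclideanSpace ℝ (Fin n) → ℝ} (hV : Measurable V)
    (hVc : ∀ p ∈ K, ∀ q ∈ K, ∀ a b : ℝ, 0 ≤ a → 0 ≤ b → a + b = 1 → V (a • p + b • q) ≤ a * V p + b * V q)
    {B : Set (EuclideanSpace ℝ (Fin m))} (hB : Convex ℝ B)
    (hint : ∀ x ∈ B, IntegrableOn (fun y => exp (-V (x, y))) (Prod.mk x ⁻¹' K))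
    (hpos : ∀ x ∈ B, 0 < ∫ y in Prod.mk x ⁻¹' K, exp (-V (x, y))) :
    ConvexOn ℝ B fun x => -log (∫ y in Prod.mk x ⁻¹' K, exp (-V (x, y))) := by
  rw [← strongConvexOn_zero]
  exact strongConvexOn_neg_log_fibreIntegral hK hKc hV (fun p hp q hq a b ha hb hab => by
    simpa using hVc p hp q hq a b ha hb hab) hB hint hpos

/-- **BRASCAMP–LIEB Thm 4.3, UNWINDOWED** (`K` = everything): `V` measurable on `ℝᵐ × ℝⁿ` with
`V(a p + b q) + (λ∕2)·a·b·‖q₁ − p₁‖² ≤ a V(p) + b V(q)`, the densities `e^{−V(x,·)}` integrable with positive integral over the convex base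
set `B` ⟹ `StrongConvexOn B λ (x ↦ −log ∫ e^{−V(x,y)} dy)`. [cite: BrascampLieb1976, Thm 4.3] -/
theorem strongConvexOn_neg_log_integral {lam : ℝ}
    {V : EuclideanSpace ℝ (Fin m) × EuclideanSpace ℝ (Fin n) → ℝ} (hV : Measurable V)
    (hVc : ∀ p q : EuclideanSpace ℝ (Fin m) × EuclideanSpace ℝ (Fin n), ∀ a b : ℝ, 0 ≤ a → 0 ≤ b → a + b = 1 →
      V (a • p + b • q) + lam / 2 * a * b * ‖q.1 - p.1‖ ^ 2 ≤ a * V p + b * V q)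
    {B : Set (EuclideanSpace ℝ (Fin m))} (hB : Convex ℝ B)
    (hint : ∀ x ∈ B, Integrable (fun y => exp (-V (x, y))))
    (hpos : ∀ x ∈ B, 0 < ∫ y, exp (-V (x, y))) :
    StrongConvexOn B lam fun x => -log (∫ y, exp (-V (x, y))) := by
  have h := strongConvexOn_neg_log_fibreIntegral (K := Set.univ) (lam := lam) MeasurableSet.univ convex_univ hV
    (fun p _ q _ a b ha hb hab => hVc p q a b ha hb hab) hB
    (fun x hx => by rw [Set.preimage_univ, integrableOn_univ]; exact hint x hx)
    (fun x hx => by rw [Set.preimage_univ, Measure.restrict_univ]; exact hpos x hx)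
  simp only [Set.preimage_univ, Measure.restrict_univ] at h
  exact h

end Marginal

/-! ## §4 Input conversions from the road's first-order currency -/

section FirstOrder

/-- **FIRST-ORDER LETTER ⟹ SECANT LETTER** on a real inner product space: if ON a convex `K`
`V x + ⟪dV x, y − x⟫ + (λ∕2)‖y − x‖² ≤ V y` for `x, y ∈ K` (the road's uniform-convexity letter; `dV` ANY vector field — a gradient is not
needed), then for `p, q ∈ K`, `a, b ≥ 0`, `a + b = 1`: `V(a p + b q) + (λ∕2)·a·b·‖q − p‖² ≤ a V(p) + b V(q)` (apply the letter at the
interpolant towards both endpoints and add). [folklore] -/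
theorem secant_of_firstOrderOn {E : Type*} [NormedAddCommGroup E] [InnerProductSpace ℝ E] {K : Set E} (hK : Convex ℝ K)
    {V : E → ℝ} {dV : E → E} {lam : ℝ}
    (h : ∀ x ∈ K, ∀ y ∈ K, V x + ⟪dV x, y - x⟫ + lam / 2 * ‖y - x‖ ^ 2 ≤ V y)
    {p q : E} (hp : p ∈ K) (hq : q ∈ K) {a b : ℝ} (ha : 0 ≤ a) (hb : 0 ≤ b) (hab : a + b = 1) :
    V (a • p + b • q) + lam / 2 * a * b * ‖q - p‖ ^ 2 ≤ a * V p + b * V q := by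
  have ha' : a = 1 - b := by linarith
  subst ha'
  have hz : (1 - b) • p + b • q ∈ K := hK hp hq ha hb hab
  have h1 := h _ hz p hp
  have h2 := h _ hz q hq
  have e1 : p - ((1 - b) • p + b • q) = b • (p - q) := by
    simp only [sub_smul, one_smul, smul_sub]; abel
  have e2 : q - ((1 - b) • p + b • q) = (1 - b) • (q - p) := by
    simp only [sub_smul, one_smul, smul_sub]; abel
  rw [e1, inner_smul_right, norm_smul, mul_pow, Real.norm_eq_abs, sq_abs, norm_sub_rev p q,
    show p - q = -(q - p) from (neg_sub q p).symm, inner_neg_right] at h1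
  rw [e2, inner_smul_right, norm_smul, mul_pow, Real.norm_eq_abs, sq_abs] at h2
  have hsum := add_le_add (mul_le_mul_of_nonneg_left h1 ha) (mul_le_mul_of_nonneg_left h2 hb)
  linear_combination hsum

variable {m n : ℕ}

/-- **THE JOINT FIRST-ORDER LETTER ON `ℝᵐ × ℝⁿ` ⟹ §3's HYPOTHESIS.**  If ON a convex `K ⊆ ℝᵐ × ℝⁿ` the exponent obeys the road's letter
with two partial fields and the product modulus, `V p + ⟪d₁V p, q₁ − p₁⟫ + ⟪d₂V p, q₂ − p₂⟫ + (λ∕2)(‖q₁ − p₁‖² + ‖q₂ − p₂‖²) ≤ V q`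
(`λ ≥ 0`), then `V(a p + b q) + (λ∕2)·a·b·‖q₁ − p₁‖² ≤ a V(p) + b V(q)` — the fibre share of the modulus is discarded. [folklore] -/
theorem secant_base_of_firstOrderOn_prod
    {K : Set (EuclideanSpace ℝ (Fin m) × EuclideanSpace ℝ (Fin n))} (hK : Convex ℝ K)
    {V : EuclideanSpace ℝ (Fin m) × EuclideanSpace ℝ (Fin n) → ℝ}
    {dV₁ : EuclideanSpace ℝ (Fin m) × EuclideanSpace ℝ (Fin n) → EuclideanSpace ℝ (Fin m)}
    {dV₂ : EuclideanSpace ℝ (Fin m) × EuclideanSpace ℝ (Fin n) → EuclideanSpace ℝ (Fin n)} {lam : ℝ} (hlam : 0 ≤ lam)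
    (h : ∀ p ∈ K, ∀ q ∈ K, V p + ⟪dV₁ p, q.1 - p.1⟫ + ⟪dV₂ p, q.2 - p.2⟫ +
      lam / 2 * (‖q.1 - p.1‖ ^ 2 + ‖q.2 - p.2‖ ^ 2) ≤ V q) :
    ∀ p ∈ K, ∀ q ∈ K, ∀ a b : ℝ, 0 ≤ a → 0 ≤ b → a + b = 1 →
      V (a • p + b • q) + lam / 2 * a * b * ‖q.1 - p.1‖ ^ 2 ≤ a * V p + b * V q := by
  intro p hp q hq a b ha hb hab
  have ha' : a = 1 - b := by linarith
  subst ha'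
  have hz : (1 - b) • p + b • q ∈ K := hK hp hq ha hb hab
  have h1 := h _ hz p hp
  have h2 := h _ hz q hq
  have e11 : p.1 - ((1 - b) • p + b • q).1 = b • (p.1 - q.1) := by
    rw [Prod.fst_add, Prod.smul_fst, Prod.smul_fst, sub_smul, one_smul, smul_sub]; abel
  have e12 : p.2 - ((1 - b) • p + b • q).2 = b • (p.2 - q.2) := by
    rw [Prod.snd_add, Prod.smul_snd, Prod.smul_snd, sub_smul, one_smul, smul_sub]; abel
  have e21 : q.1 - ((1 - b) • p + b • q).1 = (1 - b) • (q.1 - p.1) := by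
    rw [Prod.fst_add, Prod.smul_fst, Prod.smul_fst, sub_smul, one_smul, sub_smul, one_smul, smul_sub]; abel
  have e22 : q.2 - ((1 - b) • p + b • q).2 = (1 - b) • (q.2 - p.2) := by
    rw [Prod.snd_add, Prod.smul_snd, Prod.smul_snd, sub_smul, one_smul, sub_smul, one_smul, smul_sub]; abel
  rw [e11, e12, inner_smul_right, inner_smul_right, norm_smul, norm_smul, mul_pow, mul_pow, Real.norm_eq_abs, sq_abs,
    norm_sub_rev p.1 q.1, norm_sub_rev p.2 q.2,
    show p.1 - q.1 = -(q.1 - p.1) from (neg_sub q.1 p.1).symm, show p.2 - q.2 = -(q.2 - p.2) from (neg_sub q.2 p.2).symm,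
    inner_neg_right, inner_neg_right] at h1
  rw [e21, e22, inner_smul_right, inner_smul_right, norm_smul, norm_smul, mul_pow, mul_pow, Real.norm_eq_abs, sq_abs] at h2
  have hsum := add_le_add (mul_le_mul_of_nonneg_left h1 ha) (mul_le_mul_of_nonneg_left h2 hb)
  have hdrop : 0 ≤ lam / 2 * (1 - b) * b * ‖q.2 - p.2‖ ^ 2 := by positivity
  linear_combination hsum + hdrop

end FirstOrder

/-! ## §5 (appended, same seat): THE ROUND TRIP — first-order letter ⟺ `StrongConvexOn` on any real inner product space, so that
the marginal `V⁺` of §3 re-enters a socket (whose letter is first-order) as soon as the instance shows it differentiable on the window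
(differentiation under the fibre integral — the instance's, not here). -/

section RoundTrip

variable {E : Type*} [NormedAddCommGroup E] [InnerProductSpace ℝ E]
/-- **THE ROAD's FIRST-ORDER LETTER IS STRONG CONVEXITY**: on a convex `K`, `V x + ⟪dV x, y − x⟫ + (λ∕2)‖y − x‖² ≤ V y` for
`x, y ∈ K` (any vector field `dV`) ⟹ `StrongConvexOn K λ V`. [folklore] -/
theorem strongConvexOn_of_firstOrderOn {K : Set E} (hK : Convex ℝ K) {V : E → ℝ} {dV : E → E} {lam : ℝ}
    (h : ∀ x ∈ K, ∀ y ∈ K, V x + ⟪dV x, y - x⟫ + lam / 2 * ‖y - x‖ ^ 2 ≤ V y) : StrongConvexOn K lam V := by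
  refine ⟨hK, ?_⟩
  intro p hp q hq a b ha hb hab
  have hs := secant_of_firstOrderOn hK h hp hq ha hb hab
  rw [norm_sub_rev q p] at hs; simp only [smul_eq_mul]; linarith

/-- **STRONG CONVEXITY + DIFFERENTIABILITY AT THE BASE POINT ⟹ THE FIRST-ORDER LETTER THERE**: `StrongConvexOn K λ V`, `x, y ∈ K`,
`HasFDerivAt V V' x` ⟹ `V x + V'(y − x) + (λ∕2)‖y − x‖² ≤ V y` (the secant inequality along `t ↦ x + t(y − x)`, `÷ t`, `t ↓ 0`). [folklore] -/
theorem firstOrder_of_strongConvexOn_hasFDerivAt {K : Set E} {V : E → ℝ} {lam : ℝ} (hV : StrongConvexOn K lam V)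
    {x y : E} (hx : x ∈ K) (hy : y ∈ K) {V' : E →L[ℝ] ℝ} (hd : HasFDerivAt V V' x) :
    V x + V' (y - x) + lam / 2 * ‖y - x‖ ^ 2 ≤ V y := by
  have hline : HasDerivAt (fun t : ℝ => x + t • (y - x)) (y - x) 0 := by
    simpa using HasDerivAt.const_add x (HasDerivAt.smul_const (hasDerivAt_id (0 : ℝ)) (y - x))
  have hd0 : HasFDerivAt V V' ((fun t : ℝ => x + t • (y - x)) 0) := by simpa using hd
  have hslope := (HasFDerivAt.comp_hasDerivAt (0 : ℝ) hd0 hline).tendsto_slope_zero_right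
  have hev : ∀ᶠ t in nhdsWithin (0 : ℝ) (Set.Ioi 0),
      t⁻¹ • ((V ∘ fun t : ℝ => x + t • (y - x)) (0 + t) - (V ∘ fun t : ℝ => x + t • (y - x)) 0) ≤
        V y - V x - (1 - t) * (lam / 2 * ‖x - y‖ ^ 2) := by
    filter_upwards [Ioo_mem_nhdsGT (zero_lt_one' ℝ)] with t ht
    have h := hV.2 hx hy (sub_nonneg.2 ht.2.le) ht.1.le (by ring)
    rw [show (1 - t) • x + t • y = x + t • (y - x) by rw [sub_smul, one_smul, smul_sub]; abel] at h
    simp only [Function.comp_apply, zero_add, zero_smul, add_zero, smul_eq_mul] at h ⊢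
    rw [inv_mul_le_iff₀ ht.1]; nlinarith [h, ht.1]
  have hrhs : Filter.Tendsto (fun t : ℝ => V y - V x - (1 - t) * (lam / 2 * ‖x - y‖ ^ 2))
      (nhdsWithin (0 : ℝ) (Set.Ioi 0)) (nhds (V y - V x - (1 - 0) * (lam / 2 * ‖x - y‖ ^ 2))) :=
    ((continuous_const.sub ((continuous_const.sub continuous_id).mul continuous_const)).tendsto 0).mono_left
      nhdsWithin_le_nhds
  have key := le_of_tendsto_of_tendsto hslope hrhs hev
  rw [norm_sub_rev x y] at key; linarith
/-- The GRADIENT currency of the sockets: `StrongConvexOn K λ V`, `x, y ∈ K`, `HasGradientAt V g x` ⟹ the first-order letter. [folklore] -/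
theorem firstOrder_of_strongConvexOn_hasGradientAt [CompleteSpace E] {K : Set E} {V : E → ℝ} {lam : ℝ}
    (hV : StrongConvexOn K lam V) {x y : E} (hx : x ∈ K) (hy : y ∈ K) {g : E} (hd : HasGradientAt V g x) :
    V x + ⟪g, y - x⟫ + lam / 2 * ‖y - x‖ ^ 2 ≤ V y := by
  have h := firstOrder_of_strongConvexOn_hasFDerivAt hV hx hy hd.hasFDerivAt
  rwa [InnerProductSpace.toDual_apply_apply] at h
end RoundTrip

/-! ## §6 (appended gen 109): the modulus as an ARBITRARY BASE FUNCTIONAL `Q` (seminorm ∕ per-block ∕ Schur forms — refuter κ-ne7bref-g77-1: a scalar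
full-norm `λ` is volume-degenerate across steps, a seminorm form is self-sustaining; §1–§2 carry any constant `c`, so any `Q` is inherited) -/
section BaseForm
variable {m n : ℕ}
/-- **THE MARGINAL INHERITS ANY BASE MODULUS FUNCTIONAL** (secant currency): `K` convex measurable, `V` measurable with `V(a p + b q) + a·b·Q(q₁ − p₁) ≤
a V(p) + b V(q)` on `K` for some `Q : ℝᵐ → ℝ` (`½λ‖·‖²`; a weighted seminorm form `½Σ_b h_b‖π_b ·‖²`; a Schur form), the three fibre densities integrable
with positive integral ⟹ `F(a x₀ + b x₁) + a·b·Q(x₁ − x₀) ≤ a F(x₀) + b F(x₁)`, `F(x) = −log ∫_{K_x} e^{−V(x,·)}`. [cite: BrascampLieb1976, Thm 4.3] -/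
theorem neg_log_fibreIntegral_secant_of_baseForm (Q : EuclideanSpace ℝ (Fin m) → ℝ)
    {K : Set (EuclideanSpace ℝ (Fin m) × EuclideanSpace ℝ (Fin n))} (hK : MeasurableSet K) (hKc : Convex ℝ K)
    {V : EuclideanSpace ℝ (Fin m) × EuclideanSpace ℝ (Fin n) → ℝ} (hV : Measurable V)
    (hVc : ∀ p ∈ K, ∀ q ∈ K, ∀ a b : ℝ, 0 ≤ a → 0 ≤ b → a + b = 1 → V (a • p + b • q) + a * b * Q (q.1 - p.1) ≤ a * V p + b * V q)
    {B : Set (EuclideanSpace ℝ (Fin m))} (hint : ∀ x ∈ B, IntegrableOn (fun y => exp (-V (x, y))) (Prod.mk x ⁻¹' K))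
    (hpos : ∀ x ∈ B, 0 < ∫ y in Prod.mk x ⁻¹' K, exp (-V (x, y))) {x₀ x₁ : EuclideanSpace ℝ (Fin m)} (hx₀ : x₀ ∈ B) (hx₁ : x₁ ∈ B)
    {a b : ℝ} (ha : 0 ≤ a) (hb : 0 ≤ b) (hab : a + b = 1) (hxs : a • x₀ + b • x₁ ∈ B) :
    -log (∫ y in Prod.mk (a • x₀ + b • x₁) ⁻¹' K, exp (-V (a • x₀ + b • x₁, y))) + a * b * Q (x₁ - x₀) ≤
      a * -log (∫ y in Prod.mk x₀ ⁻¹' K, exp (-V (x₀, y))) + b * -log (∫ y in Prod.mk x₁ ⁻¹' K, exp (-V (x₁, y))) := by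
  rcases hb.eq_or_lt with rfl | hb0
  · have ha1 : a = 1 := by linarith
    subst ha1; simp
  rcases eq_or_lt_of_le (show b ≤ 1 by linarith) with rfl | hb1
  · have ha0 : a = 0 := by linarith
    subst ha0; simp
  have ha' : a = 1 - b := by linarith
  subst ha'
  refine neg_log_fibreIntegral_secant hb0 hb1 hK hV (fun y₀ y₁ h0 h1 => ?_) (hint x₀ hx₀) (hint x₁ hx₁) (hint _ hxs)
    (hpos x₀ hx₀) (hpos x₁ hx₁) (hpos _ hxs)
  have e : (1 - b) • (x₀, y₀) + b • (x₁, y₁) = ((1 - b) • x₀ + b • x₁, (1 - b) • y₀ + b • y₁) := by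
    simp only [Prod.smul_mk, Prod.mk_add_mk]
  refine ⟨by rw [← e]; exact hKc h0 h1 ha hb hab, ?_⟩
  have h := hVc _ h0 _ h1 (1 - b) b ha hb hab
  rwa [e] at h
end BaseForm

end Summit.QuantumFields.BalabanUV.T4Continuum.NE7b.LogConcaveMarginal
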